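import Summits.QuantumFields.YangMills.Theorems.EquipartitionCriticalityEquipartitionPinsProbeRigidityB
import HarnessLib

/-!
# Rigidity of the lattice Maxwell field under the equipartition budget — part D (budget count, Gaussian functional)

Route `EquipartitionCriticality` of `YangMills`, crux item `stmt-QuantumFields-8760`
(`EquipartitionPinsProbe`), line `Sketch`, STUB R (`stub_rigidity`) of the lead prover: every
probability measure `τ` on `ℝ^D`-valued 2-cochains `Y : ZdPlaquette 4 → Fin D → ℝ` of `ℤ⁴` that is
a.s. closed, has uniformly bounded second moments with the equipartition budget, and satisfies the
(trigonometric) Stein identity of the lattice Maxwell field IS `curvatureGaussianField 4 D`.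

This file: the counting lemma `eq_half_of_budget` (six planes × `D` colours, each `≥ ½`, total
`≤ 3D` ⇒ each `= ½`) and `main_identity`: factorization + vanishing line second moments + vanishing
line variances ⇒ `E cos⟨Y,h⟩_S = e^{−Q_S(h)/2}`, `E sin⟨Y,h⟩_S = 0`.
-/

noncomputable section

open MeasureTheory Filter Topology
open scoped BigOperators
open Literature.MathematicalPhysics.QuantumFieldTheory Literature.MathematicalPhysics.QuantumLattice
open Literature.Probability.LatticeModels

namespace Summit.QuantumFields.YangMills.Theorems.EquipartitionPinsProbe

namespace Rigidity

section Main

variable {D : ℕ} {τ : Measure (ZdPlaquette 4 → Fin D → ℝ)}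

/-- **Six planes, `D` colours, each at least `½`, total at most `3D` ⇒ each exactly `½`.** -/
theorem eq_half_of_budget (f : Fin 4 → Fin 4 → Fin D → ℝ)
    (hge : ∀ (i j : Fin 4) (hij : i < j) (a : Fin D), 1 / 2 ≤ f i j a)
    (hbudget : (∑ i : Fin 4, ∑ j : Fin 4, ∑ a : Fin D, if i < j then f i j a else 0) ≤ 3 * D) :
    ∀ (i j : Fin 4) (hij : i < j) (a : Fin D), f i j a = 1 / 2 := by
  -- the comparison family
  have hsum_g : (∑ i : Fin 4, ∑ j : Fin 4, ∑ _a : Fin D, if i < j then (1 / 2 : ℝ) else 0) = 3 * D := by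
    simp only [Finset.sum_const, Finset.card_univ, Fintype.card_fin, nsmul_eq_mul]
    simp only [Fin.sum_univ_four, Fin.isValue]
    norm_num [Fin.lt_def]
    ring
  have hle : ∀ i j (a : Fin D), (if i < j then (1 / 2 : ℝ) else 0) ≤ (if i < j then f i j a else 0) := by
    intro i j a
    split_ifs with h
    · exact hge i j h a
    · exact le_rfl
  -- the difference family is nonnegative with nonpositive sum, hence zero
  have hdiff : (∑ i : Fin 4, ∑ j : Fin 4, ∑ a : Fin D,
      ((if i < j then f i j a else 0) - (if i < j then (1 / 2 : ℝ) else 0))) = 0 := by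
    apply le_antisymm
    · rw [show (∑ i : Fin 4, ∑ j : Fin 4, ∑ a : Fin D,
          ((if i < j then f i j a else 0) - (if i < j then (1 / 2 : ℝ) else 0))) =
          (∑ i : Fin 4, ∑ j : Fin 4, ∑ a : Fin D, if i < j then f i j a else 0) -
            ∑ i : Fin 4, ∑ j : Fin 4, ∑ _a : Fin D, if i < j then (1 / 2 : ℝ) else 0 by
        simp only [Finset.sum_sub_distrib]]
      linarith
    · exact Finset.sum_nonneg fun i _ => Finset.sum_nonneg fun j _ => Finset.sum_nonneg fun a _ =>
        sub_nonneg.2 (hle i j a)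
  intro i j hij a
  have h1 : ∀ i ∈ (Finset.univ : Finset (Fin 4)), (∑ j : Fin 4, ∑ a : Fin D,
      ((if i < j then f i j a else 0) - (if i < j then (1 / 2 : ℝ) else 0))) = 0 :=
    (Finset.sum_eq_zero_iff_of_nonneg fun i _ => Finset.sum_nonneg fun j _ =>
      Finset.sum_nonneg fun a _ => sub_nonneg.2 (hle i j a)).1 hdiff
  have h2 : ∀ j ∈ (Finset.univ : Finset (Fin 4)), (∑ a : Fin D,
      ((if i < j then f i j a else 0) - (if i < j then (1 / 2 : ℝ) else 0))) = 0 :=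
    (Finset.sum_eq_zero_iff_of_nonneg fun j _ =>
      Finset.sum_nonneg fun a _ => sub_nonneg.2 (hle i j a)).1 (h1 i (Finset.mem_univ _))
  have h3 : ∀ a ∈ (Finset.univ : Finset (Fin D)),
      ((if i < j then f i j a else 0) - (if i < j then (1 / 2 : ℝ) else 0)) = 0 :=
    (Finset.sum_eq_zero_iff_of_nonneg fun a _ => sub_nonneg.2 (hle i j a)).1 (h2 j (Finset.mem_univ _))
  have := h3 a (Finset.mem_univ _)
  simp only [hij, if_true] at this
  linarith

/-- **The Gaussian characteristic functional.** Assume the factorization (F5, for this `τ`), that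
every axial line average has vanishing second moment in the limit, and that the corresponding
Gaussian variances `Q(h_L)` vanish in the limit (R4). Then `E cos⟨Y,h⟩_S = e^{−Q_S(h)/2}` and
`E sin⟨Y,h⟩_S = 0` for all `S`, `h`: compare `h` with the `k`-weighted line averages `g_L`, which
have the same plane–colour sums, and let `L → ∞`. -/
theorem main_identity [IsProbabilityMeasure τ]
    (hY : ∀ (p : ZdPlaquette 4) (a : Fin D), Integrable (fun Y => (Y p a) ^ 2) τ)
    (hF5τ : ∀ (S : Finset (ZdPlaquette 4)) (h h' : ZdPlaquette 4 → Fin D → ℝ),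
      (∀ (i j : Fin 4) (hij : i < j) (a : Fin D),
        ∑ p ∈ S, (if p.2 = ⟨(i, j), hij⟩ then h p a else 0) =
          ∑ p ∈ S, (if p.2 = ⟨(i, j), hij⟩ then h' p a else 0)) →
      (Real.exp ((∑ p ∈ S, ∑ q ∈ S, ∑ a : Fin D,
            h p a * h q a * curvatureTwoPoint p q) / 2) *
          ∫ Y, Real.cos (∑ p ∈ S, ∑ a : Fin D, h p a * Y p a) ∂τ =
        Real.exp ((∑ p ∈ S, ∑ q ∈ S, ∑ a : Fin D,
            h' p a * h' q a * curvatureTwoPoint p q) / 2) *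
          ∫ Y, Real.cos (∑ p ∈ S, ∑ a : Fin D, h' p a * Y p a) ∂τ) ∧
      (Real.exp ((∑ p ∈ S, ∑ q ∈ S, ∑ a : Fin D,
            h p a * h q a * curvatureTwoPoint p q) / 2) *
          ∫ Y, Real.sin (∑ p ∈ S, ∑ a : Fin D, h p a * Y p a) ∂τ =
        Real.exp ((∑ p ∈ S, ∑ q ∈ S, ∑ a : Fin D,
            h' p a * h' q a * curvatureTwoPoint p q) / 2) *
          ∫ Y, Real.sin (∑ p ∈ S, ∑ a : Fin D, h' p a * Y p a) ∂τ))
    (hline : ∀ (i j : Fin 4) (hij : i < j) (a : Fin D),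
      Tendsto (fun L : ℕ => ∫ Y, ((∑ t ∈ Finset.range (L + 1),
          Y ((Pi.single (0 : Fin 4) (t : ℤ) : Site 4), ⟨(i, j), hij⟩) a) / ((L + 1 : ℕ) : ℝ)) ^ 2 ∂τ)
        atTop (𝓝 0))
    (hq : ∀ (i j : Fin 4) (hij : i < j),
      Tendsto (fun L : ℕ => (∑ s ∈ Finset.range (L + 1), ∑ t ∈ Finset.range (L + 1),
          curvatureTwoPoint ((Pi.single (0 : Fin 4) (s : ℤ) : Site 4), ⟨(i, j), hij⟩)
            ((Pi.single (0 : Fin 4) (t : ℤ) : Site 4), ⟨(i, j), hij⟩)) / (((L + 1 : ℕ) : ℝ) ^ 2))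
        atTop (𝓝 0))
    (S : Finset (ZdPlaquette 4)) (h : ZdPlaquette 4 → Fin D → ℝ) :
    (∫ Y, Real.cos (∑ p ∈ S, ∑ a : Fin D, h p a * Y p a) ∂τ =
        Real.exp (-(∑ p ∈ S, ∑ q ∈ S, ∑ a : Fin D, h p a * h q a * curvatureTwoPoint p q) / 2)) ∧
      ∫ Y, Real.sin (∑ p ∈ S, ∑ a : Fin D, h p a * Y p a) ∂τ = 0 := by
  classical
  -- abbreviations
  set Q : ℝ := ∑ p ∈ S, ∑ q ∈ S, ∑ a : Fin D, h p a * h q a * curvatureTwoPoint p q with hQ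
  set C : ℝ := ∫ Y, Real.cos (∑ p ∈ S, ∑ a : Fin D, h p a * Y p a) ∂τ with hC
  set Sn : ℝ := ∫ Y, Real.sin (∑ p ∈ S, ∑ a : Fin D, h p a * Y p a) ∂τ with hSn
  -- the restricted cochain and its plane–colour sums
  set hr : ZdPlaquette 4 → Fin D → ℝ := fun p b => if p ∈ S then h p b else 0 with hhr
  set kval : Fin 4 × Fin 4 × Fin D → ℝ := fun m =>
    if hm : m.1 < m.2.1 then ∑ p ∈ S, (if p.2 = ⟨(m.1, m.2.1), hm⟩ then h p m.2.2 else 0) else 0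
    with hkval
  set M : Finset (Fin 4 × Fin 4 × Fin D) := Finset.univ.filter fun m => m.1 < m.2.1 with hM
  have hMmem : ∀ m ∈ M, m.1 < m.2.1 := fun m hm => (Finset.mem_filter.1 hm).2
  -- line cochains (length L+1) in the plane/colour of `m`, weighted by `kval m`
  set u : ℕ → Fin 4 × Fin 4 × Fin D → ZdPlaquette 4 → Fin D → ℝ := fun L m p b =>
    kval m * (if hm : m.1 < m.2.1 then (if b = m.2.2 then (∑ t ∈ Finset.range (L + 1),
      if p = (((Pi.single (0 : Fin 4) (t : ℤ) : Site 4), ⟨(m.1, m.2.1), hm⟩) : ZdPlaquette 4)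
        then (1 : ℝ) else 0) / ((L + 1 : ℕ) : ℝ) else 0) else 0) with hu
  set g : ℕ → ZdPlaquette 4 → Fin D → ℝ := fun L => ∑ m ∈ M, u L m with hg
  set SL : ℕ → Finset (ZdPlaquette 4) := fun L => S ∪ M.biUnion fun m =>
    if hm : m.1 < m.2.1 then (Finset.range (L + 1)).image fun t : ℕ =>
      (((Pi.single (0 : Fin 4) (t : ℤ) : Site 4), ⟨(m.1, m.2.1), hm⟩) : ZdPlaquette 4) else ∅
    with hSL
  have hSsub : ∀ L, S ⊆ SL L := fun L => Finset.subset_union_left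
  have hlineSub : ∀ L, ∀ m ∈ M, ∀ (hm : m.1 < m.2.1), ∀ t ∈ Finset.range (L + 1),
      (((Pi.single (0 : Fin 4) (t : ℤ) : Site 4), ⟨(m.1, m.2.1), hm⟩) : ZdPlaquette 4) ∈ SL L := by
    intro L m hmM hm t ht
    refine Finset.mem_union_right _ (Finset.mem_biUnion.2 ⟨m, hmM, ?_⟩)
    rw [dif_pos hm]
    exact Finset.mem_image_of_mem _ ht
  -- (i) `hr` and `g L` have the same plane–colour sums on `SL L`
  have hkval_eq : ∀ (i' j' : Fin 4) (hij' : i' < j') (b : Fin D),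
      kval (i', j', b) = ∑ p ∈ S, (if p.2 = ⟨(i', j'), hij'⟩ then h p b else 0) := by
    intro i' j' hij' b
    simp only [hkval, hij', dif_pos]
  have hplanes : ∀ (L : ℕ) (i' j' : Fin 4) (hij' : i' < j') (b : Fin D),
      ∑ p ∈ SL L, (if p.2 = ⟨(i', j'), hij'⟩ then hr p b else 0) =
        ∑ p ∈ SL L, (if p.2 = ⟨(i', j'), hij'⟩ then g L p b else 0) := by
    intro L i' j' hij' b
    -- left side
    rw [show (∑ p ∈ SL L, (if p.2 = ⟨(i', j'), hij'⟩ then hr p b else 0)) = kval (i', j', b) by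
      rw [hkval_eq i' j' hij' b, hhr]
      exact planeSum_restrict (hSsub L) h b ⟨(i', j'), hij'⟩]
    -- right side: expand `g L`
    have eg : ∀ p, (if p.2 = (⟨(i', j'), hij'⟩ : {q : Fin 4 × Fin 4 // q.1 < q.2}) then g L p b else 0) =
        ∑ m ∈ M, (if p.2 = (⟨(i', j'), hij'⟩ : {q : Fin 4 × Fin 4 // q.1 < q.2}) then u L m p b else 0) := by
      intro p
      simp only [hg, Finset.sum_apply]
      split_ifs <;> simp
    simp only [eg]
    rw [Finset.sum_comm]
    have em : ∀ m ∈ M, (∑ p ∈ SL L, (if p.2 = (⟨(i', j'), hij'⟩ : {q : Fin 4 × Fin 4 // q.1 < q.2})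
        then u L m p b else 0)) = if m = (i', j', b) then kval m else 0 := by
      intro m hmM
      have hm := hMmem m hmM
      have e1 : ∀ p, (if p.2 = (⟨(i', j'), hij'⟩ : {q : Fin 4 × Fin 4 // q.1 < q.2}) then u L m p b else 0) =
          kval m * (if p.2 = (⟨(i', j'), hij'⟩ : {q : Fin 4 × Fin 4 // q.1 < q.2}) then
            (if b = m.2.2 then (∑ t ∈ Finset.range (L + 1),
              if p = (((Pi.single (0 : Fin 4) (t : ℤ) : Site 4), ⟨(m.1, m.2.1), hm⟩) : ZdPlaquette 4)
                then (1 : ℝ) else 0) / ((L + 1 : ℕ) : ℝ) else 0) else 0) := by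
        intro p
        simp only [hu, dif_pos hm]
        split_ifs <;> simp
      simp only [e1, ← Finset.mul_sum]
      rw [planeSum_line m.1 m.2.1 hm (SL L) (L + 1) m.2.2 b (hlineSub L m hmM hm)]
      simp only [Finset.card_range]
      have hL1 : (((L + 1 : ℕ) : ℝ)) / ((L + 1 : ℕ) : ℝ) = 1 := div_self (by positivity)
      rw [hL1]
      by_cases hmeq : m = (i', j', b)
      · subst hmeq
        simp
      · have : ¬ ((⟨(m.1, m.2.1), hm⟩ : {q : Fin 4 × Fin 4 // q.1 < q.2}) = ⟨(i', j'), hij'⟩ ∧ b = m.2.2) := by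
          rintro ⟨h1, h2⟩
          apply hmeq
          have h1' := congrArg Subtype.val h1
          simp only [Prod.mk.injEq] at h1'
          ext <;> simp [h1'.1, h1'.2, h2]
        rw [if_neg this, if_neg hmeq, mul_zero]
    rw [Finset.sum_congr rfl em, Finset.sum_ite_eq' M (i', j', b), if_pos]
    exact Finset.mem_filter.2 ⟨Finset.mem_univ _, hij'⟩
  -- (ii) factorization: `Ψ(h) = Ψ(g L)` for every `L`
  have hΨ : ∀ L : ℕ,
      (Real.exp (Q / 2) * C =
        Real.exp ((∑ p ∈ SL L, ∑ q ∈ SL L, ∑ a : Fin D, g L p a * g L q a * curvatureTwoPoint p q) / 2) *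
          ∫ Y, Real.cos (∑ p ∈ SL L, ∑ a : Fin D, g L p a * Y p a) ∂τ) ∧
      (Real.exp (Q / 2) * Sn =
        Real.exp ((∑ p ∈ SL L, ∑ q ∈ SL L, ∑ a : Fin D, g L p a * g L q a * curvatureTwoPoint p q) / 2) *
          ∫ Y, Real.sin (∑ p ∈ SL L, ∑ a : Fin D, g L p a * Y p a) ∂τ) := by
    intro L
    have h5 := hF5τ (SL L) hr (g L) (hplanes L)
    simp only [hhr, quad_restrict (hSsub L) h, pair_restrict (hSsub L) h] at h5
    exact h5
  -- (iii) bounds on the second moment and on the Gaussian variance of `⟨Y, g L⟩`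
  have hu_eq : ∀ (L : ℕ) (m : Fin 4 × Fin 4 × Fin D) (hm : m.1 < m.2.1), u L m = fun p b =>
      kval m * (if b = m.2.2 then (∑ t ∈ Finset.range (L + 1),
        if p = (((Pi.single (0 : Fin 4) (t : ℤ) : Site 4), ⟨(m.1, m.2.1), hm⟩) : ZdPlaquette 4)
          then (1 : ℝ) else 0) / ((L + 1 : ℕ) : ℝ) else 0) := by
    intro L m hm
    funext p b
    simp only [hu, dif_pos hm]
  have hpair_u : ∀ (L : ℕ) (m : Fin 4 × Fin 4 × Fin D) (hmM : m ∈ M) (hm : m.1 < m.2.1)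
      (Y : ZdPlaquette 4 → Fin D → ℝ),
      (∑ p ∈ SL L, ∑ b : Fin D, u L m p b * Y p b) =
        kval m * ((∑ t ∈ Finset.range (L + 1),
          Y ((Pi.single (0 : Fin 4) (t : ℤ) : Site 4), ⟨(m.1, m.2.1), hm⟩) m.2.2) / ((L + 1 : ℕ) : ℝ)) := by
    intro L m hmM hm Y
    rw [hu_eq L m hm]
    simp only [pair_smul]
    rw [pair_line m.1 m.2.1 hm (SL L) (L + 1) m.2.2 (hlineSub L m hmM hm)]
  have hquad_u : ∀ (L : ℕ) (m : Fin 4 × Fin 4 × Fin D) (hmM : m ∈ M) (hm : m.1 < m.2.1),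
      (∑ p ∈ SL L, ∑ q ∈ SL L, ∑ b : Fin D, u L m p b * u L m q b * curvatureTwoPoint p q) =
        kval m ^ 2 * ((∑ s ∈ Finset.range (L + 1), ∑ t ∈ Finset.range (L + 1),
          curvatureTwoPoint ((Pi.single (0 : Fin 4) (s : ℤ) : Site 4), ⟨(m.1, m.2.1), hm⟩)
            ((Pi.single (0 : Fin 4) (t : ℤ) : Site 4), ⟨(m.1, m.2.1), hm⟩)) / (((L + 1 : ℕ) : ℝ) ^ 2)) := by
    intro L m hmM hm
    rw [hu_eq L m hm]
    simp only [quad_smul]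
    rw [quad_line m.1 m.2.1 hm (SL L) (L + 1) m.2.2 (hlineSub L m hmM hm)]
  -- the per-`m` quantities (zero outside `M`)
  set Amsq : ℕ → Fin 4 × Fin 4 × Fin D → ℝ := fun L m =>
    if hm : m.1 < m.2.1 then ∫ Y, ((∑ t ∈ Finset.range (L + 1),
      Y ((Pi.single (0 : Fin 4) (t : ℤ) : Site 4), ⟨(m.1, m.2.1), hm⟩) m.2.2) / ((L + 1 : ℕ) : ℝ)) ^ 2 ∂τ
    else 0 with hAmsq
  set qv : ℕ → Fin 4 × Fin 4 × Fin D → ℝ := fun L m =>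
    if hm : m.1 < m.2.1 then (∑ s ∈ Finset.range (L + 1), ∑ t ∈ Finset.range (L + 1),
      curvatureTwoPoint ((Pi.single (0 : Fin 4) (s : ℤ) : Site 4), ⟨(m.1, m.2.1), hm⟩)
        ((Pi.single (0 : Fin 4) (t : ℤ) : Site 4), ⟨(m.1, m.2.1), hm⟩)) / (((L + 1 : ℕ) : ℝ) ^ 2)
    else 0 with hqv
  have hm2_bound : ∀ L : ℕ, (∫ Y, (∑ p ∈ SL L, ∑ b : Fin D, g L p b * Y p b) ^ 2 ∂τ) ≤
      2 ^ M.card * ∑ m ∈ M, kval m ^ 2 * Amsq L m := by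
    intro L
    have h1 := msq_sum_le hY M (u L) (SL L)
    rw [hg]
    refine h1.trans (le_of_eq ?_)
    congr 1
    refine Finset.sum_congr rfl fun m hmM => ?_
    have hm := hMmem m hmM
    simp only [hpair_u L m hmM hm, hAmsq, dif_pos hm, mul_pow]
    rw [integral_const_mul]
  have hQ_bound : ∀ L : ℕ,
      (∑ p ∈ SL L, ∑ q ∈ SL L, ∑ b : Fin D, g L p b * g L q b * curvatureTwoPoint p q) ≤
        2 ^ M.card * ∑ m ∈ M, kval m ^ 2 * qv L m := by
    intro L
    have h1 := quad_sum_le M (u L) (SL L)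
    rw [hg]
    refine h1.trans (le_of_eq ?_)
    congr 1
    refine Finset.sum_congr rfl fun m hmM => ?_
    have hm := hMmem m hmM
    rw [hquad_u L m hmM hm, hqv]
    simp only [dif_pos hm]
  -- (iv) the bounds tend to zero
  have hAmsq_lim : ∀ m ∈ M, Tendsto (fun L => kval m ^ 2 * Amsq L m) atTop (𝓝 0) := by
    intro m hmM
    have hm := hMmem m hmM
    have := (hline m.1 m.2.1 hm m.2.2).const_mul (kval m ^ 2)
    rw [mul_zero] at this
    refine this.congr fun L => ?_
    simp only [hAmsq, dif_pos hm]
  have hqv_lim : ∀ m ∈ M, Tendsto (fun L => kval m ^ 2 * qv L m) atTop (𝓝 0) := by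
    intro m hmM
    have hm := hMmem m hmM
    have := (hq m.1 m.2.1 hm).const_mul (kval m ^ 2)
    rw [mul_zero] at this
    refine this.congr fun L => ?_
    simp only [hqv, dif_pos hm]
  have hm2_lim : Tendsto (fun L : ℕ => ∫ Y, (∑ p ∈ SL L, ∑ b : Fin D, g L p b * Y p b) ^ 2 ∂τ)
      atTop (𝓝 0) := by
    have hb : Tendsto (fun L => (2 : ℝ) ^ M.card * ∑ m ∈ M, kval m ^ 2 * Amsq L m) atTop (𝓝 0) := by
      have := (tendsto_finsetSum M fun m hmM => hAmsq_lim m hmM).const_mul ((2 : ℝ) ^ M.card)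
      simpa using this
    exact squeeze_zero (fun L => integral_nonneg fun Y => sq_nonneg _) hm2_bound hb
  have hQL_lim : Tendsto (fun L : ℕ =>
      ∑ p ∈ SL L, ∑ q ∈ SL L, ∑ b : Fin D, g L p b * g L q b * curvatureTwoPoint p q) atTop (𝓝 0) := by
    have hb : Tendsto (fun L => (2 : ℝ) ^ M.card * ∑ m ∈ M, kval m ^ 2 * qv L m) atTop (𝓝 0) := by
      have := (tendsto_finsetSum M fun m hmM => hqv_lim m hmM).const_mul ((2 : ℝ) ^ M.card)
      simpa using this
    exact squeeze_zero (fun L => stub_rigidityQuadNonneg D (SL L) (g L)) hQ_bound hb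
  -- (v) conclusion: `e^{Q_L/2} E cos⟨Y,g_L⟩ → 1`, `e^{Q_L/2} E sin⟨Y,g_L⟩ → 0`, and both are constant
  have hCL_lim : Tendsto (fun L : ℕ => ∫ Y, Real.cos (∑ p ∈ SL L, ∑ b : Fin D, g L p b * Y p b) ∂τ)
      atTop (𝓝 1) := by
    have h0 : Tendsto (fun L : ℕ => 1 - ∫ Y, Real.cos (∑ p ∈ SL L, ∑ b : Fin D, g L p b * Y p b) ∂τ)
        atTop (𝓝 0) := by
      refine squeeze_zero (fun L => (one_sub_integral_cos_mem hY (SL L) (g L)).1)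
        (fun L => (one_sub_integral_cos_mem hY (SL L) (g L)).2) ?_
      simpa using hm2_lim.div_const 2
    have := tendsto_const_nhds (x := (1 : ℝ)) |>.sub h0
    simpa using this
  have hSnL_lim : Tendsto (fun L : ℕ => ∫ Y, Real.sin (∑ p ∈ SL L, ∑ b : Fin D, g L p b * Y p b) ∂τ)
      atTop (𝓝 0) := by
    rw [Metric.tendsto_atTop]
    intro ε hε
    have hev := (Metric.tendsto_atTop.1 hm2_lim) (ε ^ 2) (by positivity)
    obtain ⟨N, hN⟩ := hev
    refine ⟨N, fun L hL => ?_⟩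
    have hm2 := hN L hL
    rw [Real.dist_eq, sub_zero, abs_of_nonneg (integral_nonneg fun Y => sq_nonneg _)] at hm2
    rw [Real.dist_eq, sub_zero]
    have hb := abs_integral_sin_le hY (SL L) (g L) hε
    have h3 : (∫ Y, (∑ p ∈ SL L, ∑ b : Fin D, g L p b * Y p b) ^ 2 ∂τ) / (2 * ε) < ε / 2 := by
      rw [div_lt_iff₀ (by positivity)]
      nlinarith
    linarith
  have hexp_lim : Tendsto (fun L : ℕ => Real.exp ((∑ p ∈ SL L, ∑ q ∈ SL L, ∑ b : Fin D,
      g L p b * g L q b * curvatureTwoPoint p q) / 2)) atTop (𝓝 1) := by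
    have h2 : Tendsto (fun L : ℕ => (∑ p ∈ SL L, ∑ q ∈ SL L, ∑ b : Fin D,
        g L p b * g L q b * curvatureTwoPoint p q) / 2) atTop (𝓝 0) := by
      simpa using hQL_lim.div_const 2
    have h3 := (Real.continuous_exp.tendsto 0).comp h2
    rw [Real.exp_zero] at h3
    exact h3
  have hprodC := hexp_lim.mul hCL_lim
  have hprodS := hexp_lim.mul hSnL_lim
  rw [mul_one] at hprodC
  rw [mul_zero] at hprodS
  have eC : Real.exp (Q / 2) * C = 1 := by
    have hconst : Tendsto (fun _ : ℕ => Real.exp (Q / 2) * C) atTop (𝓝 1) :=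
      hprodC.congr fun L => ((hΨ L).1).symm
    exact tendsto_const_nhds_iff.1 hconst
  have eS : Real.exp (Q / 2) * Sn = 0 := by
    have hconst : Tendsto (fun _ : ℕ => Real.exp (Q / 2) * Sn) atTop (𝓝 0) :=
      hprodS.congr fun L => ((hΨ L).2).symm
    exact tendsto_const_nhds_iff.1 hconst
  have hexp_pos : 0 < Real.exp (Q / 2) := Real.exp_pos _
  constructor
  · have : C = (Real.exp (Q / 2))⁻¹ := by
      field_simp
      linarith
    rw [this, ← Real.exp_neg, neg_div]
  · have := mul_eq_zero.1 eS
    rcases this with h0 | h0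
    · exact absurd h0 hexp_pos.ne'
    · exact h0

end Main

end Rigidity

/-- Registered anchor of part D: **six planes, `D` colours, each at least `½`, total at most `3D` ⇒
each exactly `½`** (see `Rigidity.eq_half_of_budget`). -/
theorem stub_rigidityEqHalfOfBudget :
    ∀ (D : ℕ) (f : Fin 4 → Fin 4 → Fin D → ℝ),
      (∀ (i j : Fin 4) (hij : i < j) (a : Fin D), 1 / 2 ≤ f i j a) →
      (∑ i : Fin 4, ∑ j : Fin 4, ∑ a : Fin D, if i < j then f i j a else 0) ≤ 3 * D →
      ∀ (i j : Fin 4) (hij : i < j) (a : Fin D), f i j a = 1 / 2 :=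
  fun _ f hge hb => Rigidity.eq_half_of_budget f hge hb

end Summit.QuantumFields.YangMills.Theorems.EquipartitionPinsProbe

end
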